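import Literature.Combinatorics.Designs.LegendrePairs.NineCompression333

/-!
# Legendre pairs of length 333: the mod-3 obstruction (RHdQ Proposition 1)

[RamosHulakDeQueiroz2026, Prop. 1]: if an `H`-invariant Legendre pair of length `333` exists then `H ≤ U₁ = {u : u ≡ 1 (mod 3)}`
— i.e. NO multiplier `u ≡ 2 (mod 3)` (in particular not `u = −1`) can fix both sequences.  This is the statement that makes
their Table A1 (the 30 subgroups of `U₁`) the complete list of candidate multiplier groups.  The paper's proof: under such a
`u` the 3-compression of either sequence has the form `(c₀, c₁, c₁)`, its DFT at a primitive cube root of unity is the integer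
`c₀ − c₁`, and the PSD identity [FletcherGysinSeberry2001] would write `2 · 333 + 2 = 668 = 4 · 167` as a sum of two integer
squares, which it is not (their Lemma 3).

This file gives an integer-only version of the same argument (no DFT): besides the diagonal compression identity
`Σ_k c̃_k² = Σ_{3 ∣ s} PAF(s)` (`sum_sq_cs3`) we use its cross form `c̃₀c̃₁ + c̃₁c̃₂ + c̃₂c̃₀ = Σ_{s ≡ 1 (3)} PAF(s)`
(`sum_cross_cs3`; both are instances of [DjokovicKotsireas2015, Thm 3]); for a Legendre pair the two right-hand sides summed
over both sequences are `446` and `−222`, and with `c̃₁ = c̃₂`, `d̃₁ = d̃₂` one gets `(c̃₀ − c̃₁)² + (d̃₀ − d̃₁)² = 668`.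
Main statements: `rhdq_prop1` (both sequences invariant under a unit `u ≡ 2 (mod 3)` is impossible),
`no_symmetric_legendrePair333` (`u = −1`), and the translation-twisted form `rhdq_prop1_twisted` via `exists_twisted_iff`.

PROVENANCE.  The statement is the published Proposition 1; the integer-only proof and the kernel check are the pub-lottery
cell's (2026-08-19).  No `native_decide`.
-/

open Finset

set_option maxRecDepth 16384

namespace Literature.Combinatorics.Designs.LegendrePairs

namespace NineComp333

/-- the cross orthogonality relation of the mod-3 class indicators. [folklore] -/
lemma key_cross (i j : ZMod 333) :
    χ 3 0 i * χ 3 1 j + χ 3 1 i * χ 3 2 j + χ 3 2 i * χ 3 0 j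
      = if j.val % 3 = (i.val % 3 + 1) % 3 then 1 else 0 := by
  have hi : i.val % 3 < 3 := Nat.mod_lt _ (by norm_num)
  have hj : j.val % 3 < 3 := Nat.mod_lt _ (by norm_num)
  unfold χ
  split_ifs <;> omega

/-- cross form of the compression identity at `d = 3`: `c̃₀c̃₁ + c̃₁c̃₂ + c̃₂c̃₀ = Σ_{s ≡ 1 (mod 3)} PAF_c(s)`.
[cite: DjokovicKotsireas2015, Thm 3 (compression identities); RamosHulakDeQueiroz2026, Lemma 2] -/
lemma sum_cross_cs3 (c : ZMod 333 → ℤ) :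
    cs 3 c 0 * cs 3 c 1 + cs 3 c 1 * cs 3 c 2 + cs 3 c 2 * cs 3 c 0 = ∑ s, χ 3 1 s * PAF c s := by
  have L : cs 3 c 0 * cs 3 c 1 + cs 3 c 1 * cs 3 c 2 + cs 3 c 2 * cs 3 c 0
      = ∑ i, ∑ j, (if j.val % 3 = (i.val % 3 + 1) % 3 then (1 : ℤ) else 0) * (c i * c j) := by
    unfold cs
    simp_rw [Finset.sum_mul_sum, ← Finset.sum_add_distrib]
    refine Finset.sum_congr rfl fun i _ => Finset.sum_congr rfl fun j _ => ?_
    rw [← key_cross i j]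
    ring
  have R : ∑ s, χ 3 1 s * PAF c s
      = ∑ i, ∑ j, (if j.val % 3 = (i.val % 3 + 1) % 3 then (1 : ℤ) else 0) * (c i * c j) := by
    unfold PAF
    simp_rw [Finset.mul_sum]
    rw [Finset.sum_comm]
    refine Finset.sum_congr rfl fun i _ => ?_
    rw [← Equiv.sum_comp (Equiv.addLeft i)
      (fun j => (if j.val % 3 = (i.val % 3 + 1) % 3 then (1 : ℤ) else 0) * (c i * c j))]
    refine Finset.sum_congr rfl fun s _ => ?_
    show χ 3 1 s * (c i * c (i + s))
      = (if (i + s).val % 3 = (i.val % 3 + 1) % 3 then (1 : ℤ) else 0) * (c i * c (i + s))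
    congr 1
    unfold χ
    have key : s.val % 3 = 1 ↔ (i + s).val % 3 = (i.val % 3 + 1) % 3 := by
      rw [val_add_mod (by decide : 3 ∣ 333)]
      have : i.val % 3 < 3 := Nat.mod_lt _ (by norm_num)
      have : s.val % 3 < 3 := Nat.mod_lt _ (by norm_num)
      omega
    by_cases h : s.val % 3 = 1
    · rw [if_pos h, if_pos (key.mp h)]
    · rw [if_neg h, if_neg (fun h' => h (key.mpr h'))]
  rw [L, R]

/-- the class `{s ≡ 1 (mod 3)}` has `111` elements. [folklore] -/
lemma card_class3_one : ∑ s : ZMod 333, χ 3 1 s = 111 := by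
  unfold χ; decide

/-- for a Legendre pair of length 333, `Σ_{s ≡ 1 (mod 3)} (PAF_a + PAF_b)(s) = −2 · 111`.
[cite: RamosHulakDeQueiroz2026, Lemma 2 / Def. 1] -/
lemma sum_theta1_paf (a b : ZMod 333 → ℤ) (h : LegendrePair a b) :
    ∑ s, χ 3 1 s * (PAF a s + PAF b s) = -222 := by
  have h0 : χ 3 1 (0 : ZMod 333) = 0 := by decide
  have : ∀ s : ZMod 333, χ 3 1 s * (PAF a s + PAF b s) = -2 * χ 3 1 s := by
    intro s
    by_cases hs : s = 0
    · subst hs; rw [h0]; ring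
    · rw [h.2.2 s hs]; ring
  rw [Finset.sum_congr rfl fun s _ => this s, ← Finset.mul_sum, card_class3_one]
  norm_num

/-- invariance under a unit `g ≡ 2 (mod 3)` swaps the classes `1` and `2 (mod 3)`, so their class sums agree.
[cite: RamosHulakDeQueiroz2026, Prop. 1 (proof: the 3-compression has the form `(c₀, c₁, c₁)`)] -/
lemma cs3_swap (c : ZMod 333 → ℤ) (g : ZMod 333) (hg : g.val % 3 = 2) (u : (ZMod 333)ˣ)
    (hu : (u : ZMod 333) = g) (hinv : ∀ i, c (g * i) = c i) : cs 3 c 2 = cs 3 c 1 := by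
  unfold cs
  rw [← Equiv.sum_comp u.mulLeft (fun j => χ 3 2 j * c j)]
  refine Finset.sum_congr rfl fun i _ => ?_
  show χ 3 2 ((u : ZMod 333) * i) * c ((u : ZMod 333) * i) = χ 3 1 i * c i
  rw [hu, hinv]
  congr 1
  unfold χ
  have key : (g * i).val % 3 = 2 ↔ i.val % 3 = 1 := by
    rw [val_mul_mod (by decide : 3 ∣ 333), Nat.mul_mod, hg]
    have : i.val % 3 < 3 := Nat.mod_lt _ (by norm_num)
    omega
  by_cases h : i.val % 3 = 1
  · rw [if_pos (key.mpr h), if_pos h]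
  · rw [if_neg (fun h' => h (key.mp h')), if_neg h]

/-- `668 = 4 · 167` is not a sum of two integer squares. [cite: RamosHulakDeQueiroz2026, Lemma 3] -/
lemma not_sq_add_sq_668 (x y : ℤ) (h : x ^ 2 + y ^ 2 = 668) : False := by
  have key : ∀ p, p < 26 → ∀ q, q < 26 → p * p + q * q ≠ 668 := by decide
  have e : ((x.natAbs * x.natAbs + y.natAbs * y.natAbs : ℕ) : ℤ) = 668 := by
    push_cast
    rw [abs_mul_abs_self, abs_mul_abs_self]
    linear_combination h
  have e' : x.natAbs * x.natAbs + y.natAbs * y.natAbs = 668 := by exact_mod_cast e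
  have bx : x.natAbs < 26 := by
    by_contra hc
    push Not at hc
    have := Nat.mul_le_mul hc hc
    omega
  have bY : y.natAbs < 26 := by
    by_contra hc
    push Not at hc
    have := Nat.mul_le_mul hc hc
    omega
  exact key _ bx _ bY e'

/-- **RHdQ Proposition 1 (the mod-3 obstruction).**  No Legendre pair of length 333 has both sequences invariant under a
unit multiplier `g ≡ 2 (mod 3)`; equivalently an `H`-invariant Legendre pair forces `H ≤ U₁ = {u ≡ 1 (mod 3)}`.
[cite: RamosHulakDeQueiroz2026, Prop. 1; integer-only proof here] -/
theorem rhdq_prop1 (a b : ZMod 333 → ℤ) (hL : LegendrePair a b) (g : ZMod 333) (u : (ZMod 333)ˣ)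
    (hu : (u : ZMod 333) = g) (hg : g.val % 3 = 2)
    (ha : ∀ i, a (g * i) = a i) (hb : ∀ i, b (g * i) = b i) : False := by
  have hN : (∑ k ∈ Finset.range 3, (cs 3 a k) ^ 2) + (∑ k ∈ Finset.range 3, (cs 3 b k) ^ 2) = 446 := by
    rw [sum_sq_cs3, sum_sq_cs3, ← Finset.sum_add_distrib, ← sum_theta_paf a b hL]
    refine Finset.sum_congr rfl fun s _ => ?_; ring
  simp only [Finset.sum_range_succ, Finset.sum_range_zero, zero_add] at hN
  have hX : (cs 3 a 0 * cs 3 a 1 + cs 3 a 1 * cs 3 a 2 + cs 3 a 2 * cs 3 a 0)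
      + (cs 3 b 0 * cs 3 b 1 + cs 3 b 1 * cs 3 b 2 + cs 3 b 2 * cs 3 b 0) = -222 := by
    rw [sum_cross_cs3, sum_cross_cs3, ← Finset.sum_add_distrib, ← sum_theta1_paf a b hL]
    refine Finset.sum_congr rfl fun s _ => ?_; ring
  have ta := cs3_swap a g hg u hu ha
  have tb := cs3_swap b g hg u hu hb
  rw [ta, tb] at hN hX
  exact not_sq_add_sq_668 (cs 3 a 0 - cs 3 a 1) (cs 3 b 0 - cs 3 b 1) (by linear_combination hN - hX)

/-- Proposition 1 for `HInvariant`. [cite: RamosHulakDeQueiroz2026, Prop. 1] -/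
theorem rhdq_prop1' (a b : ZMod 333 → ℤ) (hL : LegendrePair a b) (u : (ZMod 333)ˣ)
    (hu : (u : ZMod 333).val % 3 = 2) (ha : HInvariant a u) (hb : HInvariant b u) : False :=
  rhdq_prop1 a b hL (u : ZMod 333) u rfl hu ha hb

/-- The case `u = −1 ≡ 2 (mod 3)`: no Legendre pair of length 333 has both sequences symmetric (`x (−i) = x i`).
[cite: RamosHulakDeQueiroz2026, Prop. 1 (−1 ∉ U₁)] -/
theorem no_symmetric_legendrePair333 (a b : ZMod 333 → ℤ) (hL : LegendrePair a b)
    (ha : ∀ i, a (-i) = a i) (hb : ∀ i, b (-i) = b i) : False :=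
  rhdq_prop1 a b hL (-1) (-1) (by simp) (by decide)
    (fun i => by rw [neg_one_mul]; exact ha i) (fun i => by rw [neg_one_mul]; exact hb i)

/-- Proposition 1 for a set `H` of (possibly translation-twisted) multipliers: if `H` contains a unit `≡ 2 (mod 3)` then no
Legendre pair of length 333 has both sequences `H`-invariant, even in the twisted sense `x (t i) = x (i + c_t)`.
[cite: RamosHulakDeQueiroz2026, Prop. 1; reduction KotsireasEtAl2023, Cor. 1] -/
theorem rhdq_prop1_twisted (H : Set (ZMod 333)ˣ) (u : (ZMod 333)ˣ) (hu : (u : ZMod 333).val % 3 = 2)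
    (huH : u ∈ H) :
    ¬ ∃ a b : ZMod 333 → ℤ, LegendrePair a b ∧ (∀ t ∈ H, TwistedInvariant a t) ∧ (∀ t ∈ H, TwistedInvariant b t) := by
  rw [exists_twisted_iff]
  rintro ⟨a, b, hab, ha, hb⟩
  exact rhdq_prop1' a b hab u hu (ha u huH) (hb u huH)

end NineComp333

end Literature.Combinatorics.Designs.LegendrePairs
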